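import Literature.Analysis.FluidPDE.PassiveScalarWellPosednessProofs
import Literature.Analysis.FluidPDE.PassiveScalarClassicalEntropy
import Literature.Analysis.FunctionSpaces.TorusClassicalNSUniqueness
import HarnessLib

/-!
# Classical advection–diffusion on a half-open time window `[a, T)`: locality, uniqueness,
# exhaustion by closed windows, and existence on `[0, T)` for a drift smooth on `[0, T)`

Analysis/FluidPDE proof file (theorems only; no definitions, no named facts), the passive-scalar twin of
the bookkeeping the tree has for classical Navier–Stokes solutions
(`Torus.IsClassicalNSSolutionOn.of_local_inter`, `…velocity_unique`, `Torus.classicalNS_exhaust_Ico` in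
`TorusClassicalNSExhaustion` / `TorusClassicalNSUniqueness` / `TorusClassicalNSMaximalSolution`), for the
accepted notion `Torus.IsClassicalScalarTransportOn S κ u θ` (`PassiveScalar.lean`):

* `IsClassicalScalarTransportOn.of_local_inter` — classical solutions are LOCAL IN TIME on an arbitrary
  time set `S` (joint smoothness is local, Mathlib `contDiffOn_of_locally_contDiffOn`; the one-sided time
  derivative within `S` at `t` only sees `S ∩ O`, Mathlib `derivWithin_inter`);
* `IsClassicalScalarTransportOn.eq_of_eq` / `…eq_of_eq_of_mem` — UNIQUENESS for `κ ≥ 0`: two classical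
  solutions with the same drift on `[a, b]` (resp. on a convex time set, from any anchor time) which agree
  initially agree later (the difference is a classical solution by linearity, tree
  `IsClassicalScalarTransportOn.sub`, its `L²` norm is non-increasing, tree
  `IsClassicalScalarTransportOn.antitoneOn_scalarL2Sq`, and a smooth function with `∫ θ² ≤ 0` vanishes,
  tree `Torus.eq_zero_of_integral_norm_sq_nonpos`) — the elementary energy uniqueness quoted in the tree's
  well-posedness fact `Torus.exists_unique_isClassicalScalarTransportForcedOn` (Krylov 1996, Thm. 9.2.3 with
  the remark that uniqueness in the classical class is the energy identity for the difference);
* `Torus.classicalScalar_exhaust_Ico` — EXHAUSTION: classical solutions through `θ₀` on the closed windows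
  `[a, t]`, `a < t < T`, assemble to ONE classical solution on `[a, T)`, which agrees with every one of them;
* `Torus.exists_isClassicalScalarTransportOn_Ico` — EXISTENCE AND UNIQUENESS ON `[0, T)`: for `κ > 0`, a
  drift jointly smooth and divergence free on `[0, T) × T^d` (no regularity is asked at `t = T`, where the
  drift may degenerate) and a smooth datum there is a classical solution on `[0, T) × T^d` with `θ(0) = θ₀`,
  unique on every closed window — the tree's classical well-posedness theorem on closed windows
  (`Torus.exists_unique_isClassicalScalarTransportForcedOn_holds`, `PassiveScalarWellPosednessProofs`;
  Krylov 1996, Thm. 9.2.3) applied on each `[0, t]`, `t < T`, and exhausted.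

Use (cell `ad-ideate`, route `SawtoothPulseCascade`, crux K3loc, predicate `SawtoothCascade.DriftFree.Existence`):
the scalar transported by the cascade field `ū = P.field` (smooth on `[0,1) × 𝕋²` only, `CascadeFieldSmooth P`)
and the scalar transported by the planar Navier–Stokes velocity on `[0, 1)` are obtained from this file
(`SawtoothCascadeScalarExistence`).  WHAT THIS IS NOT: no statement about `t = T` (no uniform bounds up to the
endpoint are claimed beyond the `L²` decay that `antitoneOn_scalarL2Sq` already gives).

## Tree / Mathlib search

Tree (reused by name): `Torus.exists_unique_isClassicalScalarTransportForcedOn_holds`,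
`Torus.exists_unique_isClassicalScalarTransportOn_of_forced` (`PassiveScalarWellPosedness(Proofs)`),
`IsClassicalScalarTransportOn.sub` (`PassiveScalarClassicalEntropy`), `….restrict(_Icc)`,
`….antitoneOn_scalarL2Sq` (`PassiveScalarClassicalEnergy`), `Torus.eq_zero_of_integral_norm_sq_nonpos`
(`TorusClassicalNSUniqueness`); templates `Torus.IsClassicalNSSolutionOn.of_local_inter`,
`Torus.classicalNS_exhaust_Ico`.  `lean search 'ScalarTransportOn.of_local|Scalar.*exhaust|TransportOn_Ico'`: no hits.
Mathlib: `contDiffOn_of_locally_contDiffOn`, `derivWithin_inter`, `Filter.EventuallyEq.derivWithin_eq`.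

## References

* N. V. Krylov, *Lectures on Elliptic and Parabolic Equations in Hölder Spaces*, GSM 12, AMS 1996,
  Thm. 9.2.3 (Cauchy problem), Thm. 8.12.1 / Ex. 8.12.4 (regularity). [Krylov1996]
* A. J. Majda, A. L. Bertozzi, *Vorticity and Incompressible Flow*, CUP 2002, §3.2.3, Cor. 3.1 (restart,
  identify on the overlap, continue). [MajdaBertozziCUP2002]
* J. C. Robinson, J. L. Rodrigo, W. Sadowski, *The Three-Dimensional Navier–Stokes Equations*, CUP 2016,
  §8.1 p. 122 (the maximal half-open window). [RobinsonRodrigoSadowskiCUP2016]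
-/

open MeasureTheory Set Filter
open _root_.Topology
open scoped InnerProductSpace ContDiff

noncomputable section

namespace Literature.Analysis.FluidPDE

namespace Torus

variable {d : Type*} [Fintype d] [DecidableEq d]

/-! ## Locality in time on a general time set -/

section Local

variable {S : Set ℝ} {κ : ℝ} {u : ℝ → UnitAddTorus d → EuclideanSpace ℝ d} {θ : ℝ → UnitAddTorus d → ℝ}

/-- **Classical scalar solutions are local in time (general time set).** Let `S` be any time set and
`θ` a scalar field such that every `t ∈ S` has an open neighbourhood `O` carrying a classical solution
`θ'` of `∂ₜθ + u·∇θ = κΔθ` on `S ∩ O` (same drift and diffusivity) with `θ' = θ` on `S ∩ O`. Then `θ` is a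
classical solution on `S`: joint smoothness of the drift and of the scalar on `S × T^d` is a local property
(`contDiffOn_of_locally_contDiffOn`), and at `t ∈ S ∩ O` the time derivative within `S` equals the one
within `S ∩ O` (`derivWithin_inter`), which only sees the field on `S ∩ O` (Majda–Bertozzi 2002, §3.2.3:
solutions obtained by restarting are identified on the overlaps). [cite: MajdaBertozziCUP2002, §3.2.3 Cor. 3.1] -/
theorem IsClassicalScalarTransportOn.of_local_inter
    (h : ∀ t ∈ S, ∃ O : Set ℝ, IsOpen O ∧ t ∈ O ∧ ∃ θ' : ℝ → UnitAddTorus d → ℝ,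
      IsClassicalScalarTransportOn (S ∩ O) κ u θ' ∧ ∀ s ∈ S ∩ O, θ' s = θ s) :
    IsClassicalScalarTransportOn S κ u θ := by
  have hset : ∀ O : Set ℝ,
      (S ×ˢ (univ : Set (EuclideanSpace ℝ d))) ∩ O ×ˢ univ = (S ∩ O) ×ˢ univ := fun O => by
    rw [prod_inter_prod, inter_self]
  refine ⟨?_, ?_, fun t ht x => ?_, fun t ht => ?_⟩
  · refine contDiffOn_of_locally_contDiffOn fun z hz => ?_
    obtain ⟨t, y⟩ := z
    obtain ⟨O, hO, htO, θ', h', -⟩ := h t (mem_prod.1 hz).1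
    refine ⟨O ×ˢ univ, hO.prod isOpen_univ, ⟨htO, mem_univ _⟩, ?_⟩
    rw [hset O]
    exact h'.smooth_velocity
  · refine contDiffOn_of_locally_contDiffOn fun z hz => ?_
    obtain ⟨t, y⟩ := z
    obtain ⟨O, hO, htO, θ', h', hθ'⟩ := h t (mem_prod.1 hz).1
    refine ⟨O ×ˢ univ, hO.prod isOpen_univ, ⟨htO, mem_univ _⟩, ?_⟩
    rw [hset O]
    exact h'.smooth_scalar.congr fun z hz => by
      obtain ⟨τ, y'⟩ := z
      simp only [FunctionSpaces.Torus.stLift_apply, hθ' τ (mem_prod.1 hz).1]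
  · obtain ⟨O, hO, htO, θ', h', hθ'⟩ := h t ht
    have htO' : t ∈ S ∩ O := ⟨ht, htO⟩
    have hD : FunctionSpaces.Torus.timeDerivWithin S θ t x =
        FunctionSpaces.Torus.timeDerivWithin (S ∩ O) θ' t x := by
      simp only [FunctionSpaces.Torus.timeDerivWithin]
      rw [derivWithin_inter (hO.mem_nhds htO)]
      refine (Filter.EventuallyEq.derivWithin_eq ?_ ?_).symm
      · filter_upwards [inter_mem_nhdsWithin S (hO.mem_nhds htO)] with τ hτ
        rw [hθ' τ hτ]
      · rw [hθ' t htO']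
    rw [hD, ← hθ' t htO']
    exact h'.transport t htO' x
  · obtain ⟨O, -, htO, θ', h', -⟩ := h t ht
    exact h'.divFree t ⟨ht, htO⟩

end Local

/-! ## Uniqueness (`κ ≥ 0`) -/

section Unique

variable {S : Set ℝ} {κ a b : ℝ} {u : ℝ → UnitAddTorus d → EuclideanSpace ℝ d}
  {θ₁ θ₂ : ℝ → UnitAddTorus d → ℝ}

omit [DecidableEq d] in
/-- A smooth scalar on the torus with `‖θ‖²_{L²} ≤ 0` vanishes identically (the vector-valued tree lemma
`Torus.eq_zero_of_integral_norm_sq_nonpos` read for real values, `θ² = ‖θ‖²`). [folklore] -/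
private theorem eq_zero_of_scalarL2Sq_nonpos {θ : UnitAddTorus d → ℝ} (hθ : FunctionSpaces.Torus.IsSmooth θ)
    (h : scalarL2Sq θ ≤ 0) : θ = 0 := by
  have h' : ∫ x, ‖θ x‖ ^ 2 ≤ 0 := by
    have : (fun x => ‖θ x‖ ^ 2) = fun x => θ x ^ 2 := funext fun x => by
      rw [Real.norm_eq_abs, sq_abs]
    rw [this]
    exact h
  exact FunctionSpaces.Torus.eq_zero_of_integral_norm_sq_nonpos hθ h'

/-- **Uniqueness of classical solutions of the advection–diffusion equation on a compact time interval**
(`κ ≥ 0`): two classical solutions on `[a, b] × T^d` with the same divergence-free drift and diffusivity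
which agree at `t = a` agree on `[a, b]`. The difference is a classical solution (linearity,
`IsClassicalScalarTransportOn.sub`), its `L²` norm does not increase (`antitoneOn_scalarL2Sq`) and vanishes
initially — the energy uniqueness of the classical class recorded with the tree's well-posedness fact
(Krylov 1996, Thm. 9.2.3; `Torus.exists_unique_isClassicalScalarTransportForcedOn`).
[cite: Krylov1996, Thm. 9.2.3 (uniqueness clause)] -/
theorem IsClassicalScalarTransportOn.eq_of_eq (hκ : 0 ≤ κ)
    (h₁ : IsClassicalScalarTransportOn (Icc a b) κ u θ₁) (h₂ : IsClassicalScalarTransportOn (Icc a b) κ u θ₂)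
    (h0 : θ₁ a = θ₂ a) {t : ℝ} (ht : t ∈ Icc a b) : θ₁ t = θ₂ t := by
  rcases lt_or_ge a b with hab | hba
  · have hw := IsClassicalScalarTransportOn.sub (uniqueDiffOn_Icc hab) h₁ h₂
    have hanti := hw.antitoneOn_scalarL2Sq hκ (a := a) (b := b) Subset.rfl
    have hle : scalarL2Sq (fun x => θ₁ t x - θ₂ t x) ≤ scalarL2Sq (fun x => θ₁ a x - θ₂ a x) :=
      hanti (left_mem_Icc.2 hab.le) ht ht.1
    have hzero : scalarL2Sq (fun x => θ₁ a x - θ₂ a x) = 0 := by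
      simp [scalarL2Sq, h0]
    rw [hzero] at hle
    have hsm : FunctionSpaces.Torus.IsSmooth (fun x => θ₁ t x - θ₂ t x) :=
      (h₁.smooth_scalar.isSmooth_slice ht).sub (h₂.smooth_scalar.isSmooth_slice ht)
    have hz := eq_zero_of_scalarL2Sq_nonpos hsm hle
    funext x
    have hx := congrFun hz x
    simp only [Pi.zero_apply] at hx
    exact sub_eq_zero.1 hx
  · have hta : t = a := le_antisymm (ht.2.trans hba) ht.1
    rw [hta, h0]

/-- **Forward uniqueness from any anchor time** on a convex time set: two classical solutions with the
same drift and diffusivity `κ ≥ 0` on `S` which agree at `t₀ ∈ S` agree at every later time of `S`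
(restrict both to `[t₀, t] ⊆ S`, `IsClassicalScalarTransportOn.restrict`, and apply `eq_of_eq`).
[cite: Krylov1996, Thm. 9.2.3 (uniqueness clause)] -/
theorem IsClassicalScalarTransportOn.eq_of_eq_of_mem (hκ : 0 ≤ κ) (hS : Convex ℝ S)
    (h₁ : IsClassicalScalarTransportOn S κ u θ₁) (h₂ : IsClassicalScalarTransportOn S κ u θ₂)
    {t₀ : ℝ} (ht₀ : t₀ ∈ S) (h0 : θ₁ t₀ = θ₂ t₀) {t : ℝ} (ht : t ∈ S) (ht₀t : t₀ ≤ t) :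
    θ₁ t = θ₂ t := by
  rcases eq_or_lt_of_le ht₀t with rfl | hlt
  · exact h0
  · have hsub : Icc t₀ t ⊆ S := hS.ordConnected.out ht₀ ht
    exact (h₁.restrict_Icc hlt hsub).eq_of_eq hκ (h₂.restrict_Icc hlt hsub) h0 ⟨hlt.le, le_rfl⟩

end Unique

/-! ## Exhaustion of a half-open window `[a, T)` -/

section Exhaust

variable {κ : ℝ} {u : ℝ → UnitAddTorus d → EuclideanSpace ℝ d}

/-- **Exhaustion of a half-open window.** Let `κ ≥ 0`, `a < T`, and suppose that for every `t ∈ (a, T)`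
there is a classical solution of `∂ₜθ + u·∇θ = κΔθ` on `[a, t] × T^d` with value `θ₀` at time `a`. Then
there is ONE classical solution `Θ` on `[a, T) × T^d` with `Θ(a) = θ₀`, and every classical solution
through `θ₀` on a closed window `[a, t]`, `t < T`, coincides with `Θ` there.  Proof: choose `θ_τ` on
`[a, τ]` for each `τ`; by forward uniqueness (`eq_of_eq`) they agree on the overlaps; put
`Θ(t) = θ_{σ(t)}(t)` with `σ(t) = (t + T)/2`; near `t` the field `Θ` agrees on `[a, T) ∩ (−∞, σ(t))` with
`θ_{σ(t)}`, so `of_local_inter` applies (the scalar twin of `Torus.classicalNS_exhaust_Ico`; Majda–Bertozzi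
2002, §3.2.3: restart, identify on the overlap by uniqueness, continue).
[cite: MajdaBertozziCUP2002, §3.2.3 Cor. 3.1] -/
theorem classicalScalar_exhaust_Ico (hκ : 0 ≤ κ) {a T : ℝ} (haT : a < T) {θ₀ : UnitAddTorus d → ℝ}
    (h : ∀ t ∈ Ioo a T, ∃ θ : ℝ → UnitAddTorus d → ℝ,
      IsClassicalScalarTransportOn (Icc a t) κ u θ ∧ θ a = θ₀) :
    ∃ Θ : ℝ → UnitAddTorus d → ℝ, IsClassicalScalarTransportOn (Ico a T) κ u Θ ∧ Θ a = θ₀ ∧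
      ∀ t ∈ Ioo a T, ∀ θ' : ℝ → UnitAddTorus d → ℝ, IsClassicalScalarTransportOn (Icc a t) κ u θ' →
        θ' a = θ₀ → ∀ s ∈ Icc a t, Θ s = θ' s := by
  classical
  choose! θ hθ hθ0 using h
  -- forward uniqueness: two solutions through `θ₀` on closed windows agree where both live
  have huniq : ∀ {t t' : ℝ} {v w : ℝ → UnitAddTorus d → ℝ},
      IsClassicalScalarTransportOn (Icc a t) κ u v → IsClassicalScalarTransportOn (Icc a t') κ u w →
        v a = θ₀ → w a = θ₀ → ∀ s ∈ Icc a t, s ≤ t' → v s = w s := by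
    intro t t' v w hv hw hv0 hw0 s hs hst'
    rcases eq_or_lt_of_le hs.1 with has | has
    · rw [← has, hv0, hw0]
    · exact (hv.restrict_Icc has (Icc_subset_Icc le_rfl hs.2)).eq_of_eq hκ
        (hw.restrict_Icc has (Icc_subset_Icc le_rfl hst')) (by rw [hv0, hw0]) ⟨has.le, le_rfl⟩
  -- the index of a time: the midpoint `σ t = (t + T)/2 ∈ (t, T)`
  set σ : ℝ → ℝ := fun t => (t + T) / 2 with hσ
  have hσlt : ∀ t : ℝ, t < T → t < σ t := fun t ht => by
    simp only [hσ]; linarith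
  have hσT : ∀ t : ℝ, t < T → σ t < T := fun t ht => by
    simp only [hσ]; linarith
  have hσmem : ∀ t ∈ Ico a T, σ t ∈ Ioo a T := fun t ht =>
    ⟨lt_of_le_of_lt ht.1 (hσlt t ht.2), hσT t ht.2⟩
  refine ⟨fun t => θ (σ t) t, ?_, ?_, ?_⟩
  · refine IsClassicalScalarTransportOn.of_local_inter fun t ht => ?_
    refine ⟨Iio (σ t), isOpen_Iio, hσlt t ht.2, θ (σ t), ?_, fun s hs => ?_⟩
    · have hset : Ico a T ∩ Iio (σ t) = Ico a (σ t) := by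
        ext τ
        simp only [mem_inter_iff, mem_Ico, mem_Iio]
        constructor
        · rintro ⟨⟨h1, -⟩, h3⟩
          exact ⟨h1, h3⟩
        · rintro ⟨h1, h3⟩
          exact ⟨⟨h1, h3.trans (hσT t ht.2)⟩, h3⟩
      rw [hset]
      exact (hθ (σ t) (hσmem t ht)).restrict Ico_subset_Icc_self (uniqueDiffOn_Ico a (σ t))
    · have hs' : s ∈ Ico a T := hs.1
      exact huniq (hθ (σ t) (hσmem t ht)) (hθ (σ s) (hσmem s hs')) (hθ0 _ (hσmem t ht))
        (hθ0 _ (hσmem s hs')) s ⟨hs'.1, (mem_Iio.1 hs.2).le⟩ (hσlt s hs'.2).le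
  · show θ (σ a) a = θ₀
    exact hθ0 (σ a) (hσmem a ⟨le_rfl, haT⟩)
  · intro t ht θ' hθ' hθ'0 s hs
    show θ (σ s) s = θ' s
    have hsT : s ∈ Ico a T := ⟨hs.1, lt_of_le_of_lt hs.2 ht.2⟩
    exact huniq (hθ (σ s) (hσmem s hsT)) hθ' (hθ0 _ (hσmem s hsT)) hθ'0 s
      ⟨hs.1, (hσlt s hsT.2).le⟩ hs.2

end Exhaust

/-! ## Existence and uniqueness on `[0, T)` for a drift smooth on `[0, T)` -/

section Existence

variable {κ T : ℝ} {u : ℝ → UnitAddTorus d → EuclideanSpace ℝ d} {θ₀ : UnitAddTorus d → ℝ}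

/-- **Classical advection–diffusion on closed windows** (the tree's well-posedness theorem, recorded in the
shape consumed below): for `κ > 0`, `t > 0`, a drift jointly smooth and divergence free on `[0, t] × T^d`
and a smooth datum there is a classical solution of `∂ₜθ + u·∇θ = κΔθ` on `[0, t] × T^d` with `θ(0) = θ₀`
(Krylov 1996, Thm. 9.2.3, in the smooth periodic form of `Torus.exists_unique_isClassicalScalarTransportForcedOn`,
PROVED in `PassiveScalarWellPosednessProofs`). [cite: Krylov1996, Thm. 9.2.3] -/
theorem exists_isClassicalScalarTransportOn_Icc (hκ : 0 < κ) {t : ℝ} (ht : 0 < t)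
    (hu : FunctionSpaces.Torus.IsSmoothSpaceTimeOn (Icc 0 t) u)
    (hdiv : ∀ s ∈ Icc 0 t, FunctionSpaces.Torus.IsDivFree (u s)) (hθ₀ : FunctionSpaces.Torus.IsSmooth θ₀) :
    ∃ θ : ℝ → UnitAddTorus d → ℝ, IsClassicalScalarTransportOn (Icc 0 t) κ u θ ∧ θ 0 = θ₀ := by
  obtain ⟨θ, hθ, h0, -⟩ := exists_unique_isClassicalScalarTransportOn_of_forced
    exists_unique_isClassicalScalarTransportForcedOn_holds hκ ht hu hdiv hθ₀
  exact ⟨θ, hθ, h0⟩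

/-- **Classical advection–diffusion on a half-open window `[0, T)`.** For `κ > 0`, `T > 0`, a drift `u`
jointly smooth and divergence free on `[0, T) × T^d` (nothing is asked at `t = T`) and a smooth datum `θ₀`
there is a classical solution `θ` of `∂ₜθ + u·∇θ = κΔθ` on `[0, T) × T^d` with `θ(0) = θ₀`, and every
classical solution through `θ₀` on a closed window `[0, t]`, `t < T`, coincides with `θ` there: the
closed-window theorem (`exists_isClassicalScalarTransportOn_Icc`, Krylov 1996, Thm. 9.2.3) on each `[0, t]`,
exhausted by `classicalScalar_exhaust_Ico`. [cite: Krylov1996, Thm. 9.2.3] -/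
theorem exists_isClassicalScalarTransportOn_Ico (hκ : 0 < κ) (hT : 0 < T)
    (hu : FunctionSpaces.Torus.IsSmoothSpaceTimeOn (Ico 0 T) u)
    (hdiv : ∀ s ∈ Ico 0 T, FunctionSpaces.Torus.IsDivFree (u s)) (hθ₀ : FunctionSpaces.Torus.IsSmooth θ₀) :
    ∃ θ : ℝ → UnitAddTorus d → ℝ, IsClassicalScalarTransportOn (Ico 0 T) κ u θ ∧ θ 0 = θ₀ ∧
      ∀ t ∈ Ioo 0 T, ∀ θ' : ℝ → UnitAddTorus d → ℝ, IsClassicalScalarTransportOn (Icc 0 t) κ u θ' →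
        θ' 0 = θ₀ → ∀ s ∈ Icc 0 t, θ s = θ' s := by
  refine classicalScalar_exhaust_Ico hκ.le hT fun t ht => ?_
  have hsub : Icc 0 t ⊆ Ico 0 T := fun s hs => ⟨hs.1, hs.2.trans_lt ht.2⟩
  exact exists_isClassicalScalarTransportOn_Icc hκ ht.1 (hu.mono hsub) (fun s hs => hdiv s (hsub hs)) hθ₀

/-- **Uniqueness on the half-open window**: for `κ ≥ 0`, two classical solutions on `[0, T) × T^d` with the
same drift which agree at `t = 0` agree on `[0, T)` (`eq_of_eq_of_mem` on the convex set `[0, T)`).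
[cite: Krylov1996, Thm. 9.2.3 (uniqueness clause)] -/
theorem IsClassicalScalarTransportOn.eq_of_eq_Ico (hκ : 0 ≤ κ) {θ₁ θ₂ : ℝ → UnitAddTorus d → ℝ}
    (h₁ : IsClassicalScalarTransportOn (Ico 0 T) κ u θ₁) (h₂ : IsClassicalScalarTransportOn (Ico 0 T) κ u θ₂)
    (h0 : θ₁ 0 = θ₂ 0) {t : ℝ} (ht : t ∈ Ico 0 T) : θ₁ t = θ₂ t :=
  h₁.eq_of_eq_of_mem hκ (convex_Ico 0 T) h₂ ⟨le_rfl, ht.1.trans_lt ht.2⟩ h0 ht ht.1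

end Existence

end Torus

end Literature.Analysis.FluidPDE

end
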